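/-
Origin: expansion seat `prover-pub-hodgecm-mc-binder-2-g13-0`, handover #66 2026-08-20T07:12Z md5 7ab579d63d9a (312 l.; 9 s; imports #65; (J-dense)(iv-b) THE PLACE UNDER ι₁, GROUP LEVEL, positive W-reading: §1 **`mem_span_det2_of_circles_swap`** (any `ℂ[X_τ]` with a 2×2 array `x` and a disjoint variable set `Wv` covering the rest: row circles act by `u`, `Wv`-circle trivially, row swap by `−1` ⇒ `G ∈ ℂ∙det2 x`; tree `eq_det2_mul_of_rowSwap` + `IsWeightedHomogeneous.pderiv`), §2 `rowCircle a t`, `swapTwo` ∈ U(2) (`det_rowCircle = t`, `det_swapTwo = −1`, `swapTwo_apply`), `unitaryOfTwo eA g ∈ U(P')` (= #20 `ofVCMatrix`; `vcMatrix_unitaryOfTwo`, `vcMatrix_one'`), §3 `zArr`/`wVarsR`/`cover_pos`, `linSubst_letterOfTwo_X_z` (`z_{aj} ↦ Σ_b g_{ab} z_{bj}`), `linSubst_letter_scalar_X_w`, the three identifications `linSubst_rowCircle_eq_indScale`, `linSubst_scalarD_eq_indScale`, `linSubst_swapTwo_eq_rename` (AlgHom equalities), `rename_planeToDPIdx_detZ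 = det2 (zArr eA eR)`, **`mem_span_detZ_of_kV_det_eigen [IsEmpty S']`**: `(∀ A D, linSubst (dualPairι ((A,D),(1,1)))⋆ G = det (vcMatrix eA A) • G) → G ∈ ℂ ∙ rename (planeToDPIdx eA eR q₀ S') detZ` — pv12's printed `kappaPartI = ℂ·det z` is the whole det-isotypic part; NAME LIST `HodgeCM.Model.HypCensus.mem_span_detZ_of_kV_det_eigen` · `….mem_span_det2_of_circles_swap` · `….unitaryOfTwo`) (`HOME/mc/pub-hodgecm-mc-binder-2/g13/pkg/HodgeCM/Model/HypCensus/DenseSlotIota.lean`, md5 7ab579d63d9a, 312 lines);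
landed by the second packager p2 gen 4 (p2-g4) in gate run 44 as `HodgeCM/Model/HypCensus/DenseSlotIota.lean` (verbatim).
-/
/-
Copyright (c) 2026. All rights reserved.
Released under Apache 2.0 license as described in the file LICENSE.
-/
import Summits.HodgeConjecture.HodgeCM.Model.HypCensus.DenseSlotDelta

/-!
# (J-dense), step (iv-b) at the place under `ι₁`: the `det`-isotypic Fock polynomials of the slot are `ℂ · det z`

Binder-2 lineage, rows 18/19 (`hyp12`/`hyp34`), field `dense` of `HypCoreW`.

At the place under `ι₁` the slot is `V ≅ U(2,1)` (`P' ≃ Fin 2` through `eA`, `Q' = {q₀}`) against a DEFINITE plane `W` (positive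
reading: `R' ≃ Fin 2` through `eR`, `S' = ∅`; negative reading: `S' ≃ Fin 2`, `R' = ∅`).  A Fock polynomial `G` of the slot on which EVERY
`K_V`-letter `((A, D), (1, 1))` acts by `det (A read through eA)` (resp. its conjugate) is a multiple of the printed line
`rename (planeToDPIdx eA eR q₀ S') det z` (resp. `planeToDPIdxS`).  GROUP-level proof from three kinds of letters — the row circles
`A = diag(u, 1), diag(1, u)` (row weights `(1,1)`), the scalar `D = t · 1` (no `w`-variable occurs) and the row swap `A = (0 1; 1 0)`
(antisymmetry) — and the tree's algebraic classification `FockRowDeterminantIsotypic.eq_det2_mul_of_rowSwap`: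

* §1 `mem_span_det2_of_circles_swap` — the abstract statement in any polynomial ring;
* §2 `rowCircle`, `swapTwo` (elements of `U(2)`), `unitaryOfTwo eA g ∈ U(P')` and the substitution formulas;
* §3 **`mem_span_detZ_of_kV_det_eigen`** (positive `W`-reading); the negative reading is the sibling leaf `DenseSlotIotaNeg`.

[KashiwaraVergne1978, Ch. III §5; Adams2007Theta, Prop. 6.6; folklore]  Nothing here is a claim of PerL/QW8.
-/

noncomputable section

open MvPolynomial Complex
open scoped BigOperators ComplexConjugate
open Literature.Analysis.SegalBargmann

namespace HodgeCM.Model.HypCensus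

/-! ## §1 The abstract statement -/

section Abstract

variable {τ : Type} [Fintype τ] [DecidableEq τ]

/-- **`det`-lines from circles and the swap.**  In a polynomial ring with a `2 × 2` array of variables `x` and a set of variables
`Wv` off the array, together covering all variables: if the two row circles act on `G` by `u`, the `Wv`-circle trivially, and the
row swap by `−1`, then `G ∈ ℂ · det2 x`. [KashiwaraVergne1978, Ch. III §5; folklore] -/
theorem mem_span_det2_of_circles_swap (x : Fin 2 → Fin 2 → τ) (hx : Function.Injective fun p : Fin 2 × Fin 2 => x p.1 p.2)
    (Wv : Finset τ) (hdisj : ∀ a j, x a j ∉ Wv) (hcover : ∀ i, i ∈ rowVars x 0 ∨ i ∈ rowVars x 1 ∨ i ∈ Wv) {G : MvPolynomial τ ℂ}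
    (h0 : ∀ u : ℂ, ‖u‖ = 1 → linSubst (indScale (rowVars x 0) u) G = u • G)
    (h1 : ∀ u : ℂ, ‖u‖ = 1 → linSubst (indScale (rowVars x 1) u) G = u • G)
    (hW : ∀ u : ℂ, ‖u‖ = 1 → linSubst (indScale Wv u) G = G) (hS : rename (rowSwap x) G = -G) :
    G ∈ Submodule.span ℂ ({det2 x} : Set (MvPolynomial τ ℂ)) := by
  have hr0 : IsWeightedHomogeneous (rowWt x 0) G 1 :=
    isWeightedHomogeneous_indWt_of_linSubst _ fun u hu => by rw [pow_one]; exact h0 u hu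
  have hr1 : IsWeightedHomogeneous (rowWt x 1) G 1 :=
    isWeightedHomogeneous_indWt_of_linSubst _ fun u hu => by rw [pow_one]; exact h1 u hu
  have hw : IsWeightedHomogeneous (indWt Wv) G 0 :=
    isWeightedHomogeneous_indWt_of_linSubst _ fun u hu => by rw [pow_zero, one_smul]; exact hW u hu
  obtain ⟨hG, hH⟩ := eq_det2_mul_of_rowSwap hx hr0 hr1 hS
  have hHw : IsWeightedHomogeneous (indWt Wv) (pderiv (x 1 1) (pderiv (x 0 0) G)) 0 := by
    refine (hw.pderiv (n' := 0) ?_).pderiv (n' := 0) ?_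
    · rw [zero_add]; exact if_neg (hdisj 0 0)
    · rw [zero_add]; exact if_neg (hdisj 1 1)
  have hHu : IsWeightedHomogeneous (indWt (Finset.univ : Finset τ)) (pderiv (x 1 1) (pderiv (x 0 0) G)) 0 := by
    intro d hd
    rw [weight_indWt]
    refine Finset.sum_eq_zero fun i _ => ?_
    by_contra hdi
    rcases hcover i with h | h | h
    · exact hd (coeff_eq_zero_of_indWt_zero (hH 0) h hdi)
    · exact hd (coeff_eq_zero_of_indWt_zero (hH 1) h hdi)
    · exact hd (coeff_eq_zero_of_indWt_zero hHw h hdi)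
  have hC := eq_C_of_isWeightedHomogeneous_indWt_univ_zero hHu
  rw [hG, hC, mul_comm, ← smul_eq_C_mul]
  exact Submodule.smul_mem _ _ (Submodule.mem_span_singleton_self _)

end Abstract

/-! ## §2 Three elements of `U(2)` and their letters -/

section Two

/-- a unimodular number times its conjugate is `1`. -/
theorem circle_coe_mul_star (t : Circle) : (t : ℂ) * star (t : ℂ) = 1 := by
  rw [Complex.star_def, Complex.mul_conj, Circle.normSq_coe, Complex.ofReal_one]

/-- **the row circle** `diag(t at a, 1 elsewhere) ∈ U(2)`. -/
def rowCircle (a : Fin 2) (t : Circle) : Matrix.unitaryGroup (Fin 2) ℂ :=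
  ⟨Matrix.diagonal fun b => if b = a then (t : ℂ) else 1, by
    rw [Matrix.mem_unitaryGroup_iff, Matrix.star_eq_conjTranspose, Matrix.diagonal_conjTranspose, Matrix.diagonal_mul_diagonal,
      ← Matrix.diagonal_one]
    congr 1
    funext b
    by_cases hb : b = a
    · rw [if_pos hb, Pi.star_apply, if_pos hb, circle_coe_mul_star]
    · rw [if_neg hb, Pi.star_apply, if_neg hb, star_one, mul_one]⟩

/-- (Ported verbatim from the HodgeCMPerL package; no docstring in the source.) -/
@[simp] theorem coe_rowCircle (a : Fin 2) (t : Circle) :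
    ((rowCircle a t : Matrix.unitaryGroup (Fin 2) ℂ) : Matrix (Fin 2) (Fin 2) ℂ) = Matrix.diagonal fun b => if b = a then (t : ℂ) else 1 :=
  rfl

/-- (Ported verbatim from the HodgeCMPerL package; no docstring in the source.) -/
theorem det_rowCircle (a : Fin 2) (t : Circle) : ((rowCircle a t : Matrix.unitaryGroup (Fin 2) ℂ) : Matrix (Fin 2) (Fin 2) ℂ).det = t := by
  rw [coe_rowCircle, Matrix.det_diagonal, Fin.prod_univ_two]
  fin_cases a <;> simp

/-- **the row swap** `(0 1; 1 0) ∈ U(2)`. -/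
def swapTwo : Matrix.unitaryGroup (Fin 2) ℂ :=
  ⟨!![0, 1; 1, 0], by
    rw [Matrix.mem_unitaryGroup_iff]
    ext i j
    fin_cases i <;> fin_cases j <;> simp [Matrix.mul_apply, Fin.sum_univ_two, Matrix.star_apply]⟩

/-- (Ported verbatim from the HodgeCMPerL package; no docstring in the source.) -/
@[simp] theorem coe_swapTwo : ((swapTwo : Matrix.unitaryGroup (Fin 2) ℂ) : Matrix (Fin 2) (Fin 2) ℂ) = !![0, 1; 1, 0] := rfl

/-- (Ported verbatim from the HodgeCMPerL package; no docstring in the source.) -/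
theorem det_swapTwo : ((swapTwo : Matrix.unitaryGroup (Fin 2) ℂ) : Matrix (Fin 2) (Fin 2) ℂ).det = -1 := by
  rw [coe_swapTwo, Matrix.det_fin_two_of]; ring

/-- (Ported verbatim from the HodgeCMPerL package; no docstring in the source.) -/
theorem swapTwo_apply (a b : Fin 2) :
    ((swapTwo : Matrix.unitaryGroup (Fin 2) ℂ) : Matrix (Fin 2) (Fin 2) ℂ) a b = if b = Equiv.swap (0 : Fin 2) 1 a then 1 else 0 := by
  fin_cases a <;> fin_cases b <;> simp [Equiv.swap_apply_left, Equiv.swap_apply_right]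

variable {P' : Type} [Fintype P'] [DecidableEq P'] (eA : Fin 2 ≃ P')

/-- a `2 × 2` unitary as an element of `U(P')` through the frame `eA` (#20's `ofVCMatrix`). -/
def unitaryOfTwo (g : Matrix.unitaryGroup (Fin 2) ℂ) : Matrix.unitaryGroup P' ℂ :=
  ⟨ofVCMatrix eA (g : Matrix (Fin 2) (Fin 2) ℂ), ofVCMatrix_mem_unitaryGroup eA g⟩

/-- (Ported verbatim from the HodgeCMPerL package; no docstring in the source.) -/
@[simp] theorem coe_unitaryOfTwo_apply (g : Matrix.unitaryGroup (Fin 2) ℂ) (p p' : P') :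
    ((unitaryOfTwo eA g : Matrix.unitaryGroup P' ℂ) : Matrix P' P' ℂ) p p' = (g : Matrix (Fin 2) (Fin 2) ℂ) (eA.symm p') (eA.symm p) := rfl

/-- (Ported verbatim from the HodgeCMPerL package; no docstring in the source.) -/
theorem vcMatrix_unitaryOfTwo (g : Matrix.unitaryGroup (Fin 2) ℂ) :
    vcMatrix eA ((unitaryOfTwo eA g : Matrix.unitaryGroup P' ℂ) : Matrix P' P' ℂ) = (g : Matrix (Fin 2) (Fin 2) ℂ) :=
  vcMatrix_ofVCMatrix eA _

omit [Fintype P'] in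
/-- `vcMatrix eA 1 = 1`. -/
theorem vcMatrix_one' : vcMatrix eA (1 : Matrix P' P' ℂ) = 1 := by
  funext i i'
  by_cases h : i = i'
  · subst h; simp [vcMatrix]
  · have h' : eA i' ≠ eA i := fun e => h (eA.injective e).symm
    rw [vcMatrix, Matrix.one_apply_ne h', Matrix.one_apply_ne h]

end Two

/-! ## §3 The positive `W`-reading -/

section Pos

variable {P' Q' R' S' : Type} [Fintype P'] [DecidableEq P'] [Fintype Q'] [DecidableEq Q'] [Fintype R'] [DecidableEq R']
  [Fintype S'] [DecidableEq S']
variable (eA : Fin 2 ≃ P') (eR : Fin 2 ≃ R') (q₀ : Q')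

/-- the array of `z`-variables `z_{aj} = X_{(eA a, eR j)}` (block `P × R`). -/
def zArr : Fin 2 → Fin 2 → DPIdx P' Q' R' S' := fun a j => Sum.inl (Sum.inl (eA a, eR j))

/-- the `w`-variables: the whole block `Q × R`. -/
def wVarsR : Finset (DPIdx P' Q' R' S') := Finset.univ.image fun qr : Q' × R' => Sum.inr (Sum.inr qr)

omit [DecidableEq P'] [Fintype Q'] [DecidableEq Q'] [DecidableEq R'] [Fintype S'] [DecidableEq S'] [Fintype P'] [Fintype R'] in
/-- (Ported verbatim from the HodgeCMPerL package; no docstring in the source.) -/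
theorem zArr_injective : Function.Injective fun p : Fin 2 × Fin 2 => zArr (Q' := Q') (S' := S') eA eR p.1 p.2 := by
  rintro ⟨a, j⟩ ⟨a', j'⟩ h
  simp only [zArr, Sum.inl.injEq, Prod.mk.injEq, eA.injective.eq_iff, eR.injective.eq_iff] at h
  exact Prod.ext h.1 h.2

omit [Fintype S'] [Fintype P'] in
/-- (Ported verbatim from the HodgeCMPerL package; no docstring in the source.) -/
theorem inl_inl_notMem_wVarsR (p : P') (r : R') :
    (Sum.inl (Sum.inl (p, r)) : DPIdx P' Q' R' S') ∉ wVarsR (P' := P') (Q' := Q') (R' := R') (S' := S') := by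
  simp [wVarsR]

omit [Fintype S'] [Fintype P'] in
/-- (Ported verbatim from the HodgeCMPerL package; no docstring in the source.) -/
theorem zArr_notMem_wVarsR (a j : Fin 2) : zArr eA eR a j ∉ wVarsR (P' := P') (Q' := Q') (R' := R') (S' := S') :=
  inl_inl_notMem_wVarsR _ _

omit [Fintype Q'] [Fintype S'] [Fintype P'] [Fintype R'] in
/-- (Ported verbatim from the HodgeCMPerL package; no docstring in the source.) -/
theorem mem_rowVars_zArr_iff (a b : Fin 2) (j : Fin 2) : zArr (Q' := Q') (S' := S') eA eR b j ∈ rowVars (zArr eA eR) a ↔ b = a := by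
  constructor
  · intro h
    obtain ⟨j', _, hj'⟩ := Finset.mem_image.mp h
    have := zArr_injective eA eR (a₁ := (a, j')) (a₂ := (b, j)) hj'
    exact ((Prod.mk.inj this).1).symm
  · rintro rfl; exact mem_rowVars b j

omit [Fintype Q'] [Fintype S'] [Fintype P'] [Fintype R'] in
/-- (Ported verbatim from the HodgeCMPerL package; no docstring in the source.) -/
theorem inr_inr_notMem_rowVars (a : Fin 2) (q : Q') (r : R') :
    (Sum.inr (Sum.inr (q, r)) : DPIdx P' Q' R' S') ∉ rowVars (zArr eA eR) a := by
  intro h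
  obtain ⟨j', _, hj'⟩ := Finset.mem_image.mp h
  exact Sum.inl_ne_inr hj'

omit [Fintype S'] [Fintype P'] in
/-- every variable of the positively read `ι₁` slot is a `z`- or a `w`-variable. -/
theorem cover_pos [IsEmpty S'] (i : DPIdx P' Q' R' S') :
    i ∈ rowVars (zArr eA eR) 0 ∨ i ∈ rowVars (zArr eA eR) 1 ∨ i ∈ wVarsR (P' := P') (Q' := Q') (R' := R') (S' := S') := by
  rcases i with (⟨p, r⟩ | ⟨q, s⟩) | (⟨p, s⟩ | ⟨q, r⟩)
  · obtain ⟨a, rfl⟩ := eA.surjective p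
    obtain ⟨j, rfl⟩ := eR.surjective r
    fin_cases a
    · exact Or.inl (mem_rowVars (x := zArr eA eR) 0 j)
    · exact Or.inr (Or.inl (mem_rowVars (x := zArr eA eR) 1 j))
  · exact isEmptyElim s
  · exact isEmptyElim s
  · exact Or.inr (Or.inr (Finset.mem_image.mpr ⟨(q, r), Finset.mem_univ _, rfl⟩))

/-- the letter `((g through eA, t·1), (1,1))` on a `z`-variable: `z_{aj} ↦ Σ_b g_{ab} z_{bj}`. -/
theorem linSubst_letterOfTwo_X_z (g : Matrix.unitaryGroup (Fin 2) ℂ) (D : Matrix.unitaryGroup Q' ℂ) (a j : Fin 2) :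
    linSubst (star ((dualPairι (((unitaryOfTwo eA g, D), (1, 1)) : DPK P' Q' R' S') : Matrix.unitaryGroup (DPIdx P' Q' R' S') ℂ) :
        Matrix (DPIdx P' Q' R' S') (DPIdx P' Q' R' S') ℂ)) (X (zArr eA eR a j)) =
      ∑ b : Fin 2, C ((g : Matrix (Fin 2) (Fin 2) ℂ) a b) * X (zArr eA eR b j) := by
  rw [zArr, linSubst_star_dualPairι_kV_X_inl_inl, ← eA.sum_comp]
  simp only [coe_unitaryOfTwo_apply, Equiv.symm_apply_apply, zArr]

/-- the letter `((A, t·1), (1,1))` on a `w`-variable: `X_{(q,r)} ↦ conj t · X_{(q,r)}`. -/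
theorem linSubst_letter_scalar_X_w (A : Matrix.unitaryGroup P' ℂ) (t : Circle) (q : Q') (r : R') :
    linSubst (star ((dualPairι (((A, circleScalarUnitary Q' t), (1, 1)) : DPK P' Q' R' S') : Matrix.unitaryGroup (DPIdx P' Q' R' S') ℂ) :
        Matrix (DPIdx P' Q' R' S') (DPIdx P' Q' R' S') ℂ)) (X (Sum.inr (Sum.inr (q, r)))) =
      C (conj (t : ℂ)) * X (Sum.inr (Sum.inr (q, r))) := by
  rw [linSubst_star_dualPairι_X_QR_general]
  simp only [coe_circleScalarUnitary, OneMemClass.coe_one, Matrix.smul_apply, Matrix.one_apply, smul_eq_mul, mul_ite,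
    mul_one, mul_zero, apply_ite star, star_one, star_zero, ite_mul, zero_mul, apply_ite C, map_zero, Finset.sum_ite_eq',
    Finset.mem_univ, if_true, star_def]

/-- the row-circle letter IS the circle scaling of the row variables. -/
theorem linSubst_rowCircle_eq_indScale [IsEmpty S'] (a : Fin 2) (t : Circle) :
    linSubst (star ((dualPairι (((unitaryOfTwo eA (rowCircle a t), (1 : Matrix.unitaryGroup Q' ℂ)), (1, 1)) : DPK P' Q' R' S') :
        Matrix.unitaryGroup (DPIdx P' Q' R' S') ℂ) : Matrix (DPIdx P' Q' R' S') (DPIdx P' Q' R' S') ℂ)) =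
      linSubst (indScale (rowVars (zArr eA eR) a) (t : ℂ)) := by
  refine MvPolynomial.algHom_ext fun i => ?_
  rcases i with (⟨p, r⟩ | ⟨q, s⟩) | (⟨p, s⟩ | ⟨q, r⟩)
  · obtain ⟨b, rfl⟩ := eA.surjective p
    obtain ⟨j, rfl⟩ := eR.surjective r
    rw [show (Sum.inl (Sum.inl (eA b, eR j)) : DPIdx P' Q' R' S') = zArr eA eR b j from rfl, linSubst_letterOfTwo_X_z,
      linSubst_indScale_X, Fin.sum_univ_two]
    simp only [mem_rowVars_zArr_iff, coe_rowCircle]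
    fin_cases a <;> fin_cases b <;> simp [Matrix.diagonal]
  · exact isEmptyElim s
  · exact isEmptyElim s
  · have h1 : (1 : Matrix.unitaryGroup Q' ℂ) = circleScalarUnitary Q' 1 :=
      Subtype.ext (by rw [coe_circleScalarUnitary, Circle.coe_one, one_smul]; rfl)
    rw [h1, linSubst_letter_scalar_X_w, linSubst_indScale_X, if_neg (inr_inr_notMem_rowVars eA eR a q r), Circle.coe_one, map_one]

/-- the scalar-`D` letter IS the circle scaling of the `w`-variables. -/
theorem linSubst_scalarD_eq_indScale [IsEmpty S'] (t : Circle) :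
    linSubst (star ((dualPairι ((((1 : Matrix.unitaryGroup P' ℂ), circleScalarUnitary Q' t), (1, 1)) : DPK P' Q' R' S') :
        Matrix.unitaryGroup (DPIdx P' Q' R' S') ℂ) : Matrix (DPIdx P' Q' R' S') (DPIdx P' Q' R' S') ℂ)) =
      linSubst (indScale (wVarsR (P' := P') (Q' := Q') (R' := R') (S' := S')) (conj (t : ℂ))) := by
  refine MvPolynomial.algHom_ext fun i => ?_
  rcases i with (⟨p, r⟩ | ⟨q, s⟩) | (⟨p, s⟩ | ⟨q, r⟩)
  · rw [linSubst_star_dualPairι_kV_X_inl_inl, linSubst_indScale_X,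
      if_neg (inl_inl_notMem_wVarsR (P' := P') (Q' := Q') (R' := R') (S' := S') p r), map_one, one_mul]
    simp only [OneMemClass.coe_one, Matrix.one_apply, apply_ite C, map_one, map_zero, ite_mul, one_mul, zero_mul,
      Finset.sum_ite_eq', Finset.mem_univ, if_true]
  · exact isEmptyElim s
  · exact isEmptyElim s
  · have hm : (Sum.inr (Sum.inr (q, r)) : DPIdx P' Q' R' S') ∈ wVarsR (P' := P') (Q' := Q') (R' := R') (S' := S') :=
      Finset.mem_image.mpr ⟨(q, r), Finset.mem_univ _, rfl⟩
    rw [linSubst_letter_scalar_X_w, linSubst_indScale_X, if_pos hm]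

/-- the swap letter IS the renaming by the row swap. -/
theorem linSubst_swapTwo_eq_rename [IsEmpty S'] :
    linSubst (star ((dualPairι (((unitaryOfTwo eA swapTwo, (1 : Matrix.unitaryGroup Q' ℂ)), (1, 1)) : DPK P' Q' R' S') :
        Matrix.unitaryGroup (DPIdx P' Q' R' S') ℂ) : Matrix (DPIdx P' Q' R' S') (DPIdx P' Q' R' S') ℂ)) =
      (rename (rowSwap (zArr (Q' := Q') (S' := S') eA eR)) :
        MvPolynomial (DPIdx P' Q' R' S') ℂ →ₐ[ℂ] MvPolynomial (DPIdx P' Q' R' S') ℂ) := by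
  refine MvPolynomial.algHom_ext fun i => ?_
  rcases i with (⟨p, r⟩ | ⟨q, s⟩) | (⟨p, s⟩ | ⟨q, r⟩)
  · obtain ⟨b, rfl⟩ := eA.surjective p
    obtain ⟨j, rfl⟩ := eR.surjective r
    rw [show (Sum.inl (Sum.inl (eA b, eR j)) : DPIdx P' Q' R' S') = zArr eA eR b j from rfl, linSubst_letterOfTwo_X_z, rename_X,
      Fin.sum_univ_two]
    fin_cases b
    · rw [show zArr (Q' := Q') (S' := S') eA eR ((fun i => i) ⟨0, by decide⟩) j = zArr eA eR 0 j from rfl,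
        rowSwap_apply_row0 (zArr_injective eA eR)]
      simp [swapTwo_apply]
    · rw [show zArr (Q' := Q') (S' := S') eA eR ((fun i => i) ⟨1, by decide⟩) j = zArr eA eR 1 j from rfl,
        rowSwap_apply_row1 (zArr_injective eA eR)]
      simp [swapTwo_apply]
  · exact isEmptyElim s
  · exact isEmptyElim s
  · have h1 : (1 : Matrix.unitaryGroup Q' ℂ) = circleScalarUnitary Q' 1 :=
      Subtype.ext (by rw [coe_circleScalarUnitary, Circle.coe_one, one_smul]; rfl)
    rw [h1, linSubst_letter_scalar_X_w, rename_X, rowSwap_apply_of_notMem (inr_inr_notMem_rowVars eA eR 0 q r)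
      (inr_inr_notMem_rowVars eA eR 1 q r), Circle.coe_one, map_one, map_one, one_mul]

omit [Fintype P'] [DecidableEq P'] [Fintype Q'] [DecidableEq Q'] [Fintype R'] [DecidableEq R'] [Fintype S'] [DecidableEq S'] in
/-- the printed line renames to `det2` of the array. -/
theorem rename_planeToDPIdx_detZ :
    rename (planeToDPIdx eA eR q₀ S') HodgeCM.PerL34.Fock.detZ = det2 (zArr (Q' := Q') (S' := S') eA eR) := by
  simp only [HodgeCM.PerL34.Fock.detZ, HodgeCM.PerL34.Fock.z, map_sub, map_mul, rename_X, planeToDPIdx_z, det2, zArr]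

/-- **THE `det`-ISOTYPIC FOCK POLYNOMIALS OF THE `ι₁` SLOT ARE `ℂ · det z`** (positive `W`-reading: `S' = ∅`, `R' ≃ Fin 2`):
if every `K_V`-letter `((A, D), (1, 1))` acts on `G` by `det (A read through eA)`, then `G ∈ ℂ · rename (planeToDPIdx eA eR q₀ S') det z`.
[KashiwaraVergne1978, Ch. III §5; Adams2007Theta, Prop. 6.6] -/
theorem mem_span_detZ_of_kV_det_eigen [IsEmpty S'] (G : MvPolynomial (DPIdx P' Q' R' S') ℂ)
    (h : ∀ (A : Matrix.unitaryGroup P' ℂ) (D : Matrix.unitaryGroup Q' ℂ),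
      linSubst (star ((dualPairι (((A, D), (1, 1)) : DPK P' Q' R' S') : Matrix.unitaryGroup (DPIdx P' Q' R' S') ℂ) :
          Matrix (DPIdx P' Q' R' S') (DPIdx P' Q' R' S') ℂ)) G = (vcMatrix eA (A : Matrix P' P' ℂ)).det • G) :
    G ∈ Submodule.span ℂ ({rename (planeToDPIdx eA eR q₀ S') HodgeCM.PerL34.Fock.detZ} : Set (MvPolynomial (DPIdx P' Q' R' S') ℂ)) := by
  rw [rename_planeToDPIdx_detZ]
  refine mem_span_det2_of_circles_swap (zArr eA eR) (zArr_injective eA eR) wVarsR (zArr_notMem_wVarsR eA eR) (cover_pos eA eR)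
    (fun u hu => ?_) (fun u hu => ?_) (fun u hu => ?_) ?_
  · have := h (unitaryOfTwo eA (rowCircle 0 (circleOfNorm u hu))) 1
    rwa [vcMatrix_unitaryOfTwo, det_rowCircle, coe_circleOfNorm, linSubst_rowCircle_eq_indScale, coe_circleOfNorm] at this
  · have := h (unitaryOfTwo eA (rowCircle 1 (circleOfNorm u hu))) 1
    rwa [vcMatrix_unitaryOfTwo, det_rowCircle, coe_circleOfNorm, linSubst_rowCircle_eq_indScale, coe_circleOfNorm] at this
  · have := h 1 (circleScalarUnitary Q' (circleOfNorm u hu)⁻¹)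
    rwa [OneMemClass.coe_one, vcMatrix_one', Matrix.det_one, one_smul, linSubst_scalarD_eq_indScale, ← Circle.coe_inv_eq_conj,
      inv_inv, coe_circleOfNorm] at this
  · have := h (unitaryOfTwo eA swapTwo) 1
    rwa [vcMatrix_unitaryOfTwo, det_swapTwo, linSubst_swapTwo_eq_rename, neg_one_smul] at this

end Pos

end HodgeCM.Model.HypCensus

end
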